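import Summits.ABC.IUTFork.Thm311RealInd1StripTwistMoverJWUnits
import Literature.AnabelianGeometry.AbsoluteAnabelian.MLFGaloisDehnTwistTransvectionsAllProofs
import HarnessLib

/-!
# [IUTchIII] Thm 3.11 (i) (Ind1) at `v ∈ 𝕍^non`: the twist MOVER under the MASTER hypothesis (all Jannsen–Wingberg planes)

PROOF-ONLY corollary sheet (abc-iut cell, Cor. 3.12 sub-crew, seat abc-iut-c312-1 gen 9; row «R10 IND1-STRIP-MOVER-JW»).
TAKES NO SIDE on [IUTchIII] Cor. 3.12.  The named fact `DehnTwistTransvectionsOnUnitsAll` (K. Kondo arXiv:2512.09231 §2 in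
full: ONE `ℚ_p`-basis, every twist plane carries both realised transvections, unit-restricted) is the master hypothesis for
the successor «all planes» obstruction (`f` odd, `e ≥ 3`); it implies the one-pair fact (`dehnTwistTransvectionsOnUnits_of_all`),
hence already the `f = 1` mover of record.  Recorded here so that consumers can carry ONE binder:
`Real.exists_mem_ind1StripOf_galoisLog_image_closedBall_ne_of_dehnTwistsAll` / `…_analyticLogv_…`.
[claim: Mochizuki2012, status: disputed]; [cite: Kondo2025OuterAutMLF, §2 Thm 2.1 and proof of Thm 2.3 p.10];
[cite: DupuyHilado2025, §4.7].  typed ≠ proved; a conditional theorem discharges nothing it binds.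
-/

set_option autoImplicit false

noncomputable section

open Metric Set

namespace Summit.ABC.IUTFork.Thm311.Real

open NumberField IsDedekindDomain Literature.NumberTheory.NumberFields Literature.IUT.LogVolume
open Literature.NumberTheory.GaloisRepresentations.Ultrametric Literature.AnabelianGeometry.AbsoluteAnabelian

variable {F : Type} [Field F] [NumberField F] (v : HeightOneSpectrum (𝓞 F))

/-- **The `f = 1` mover under the master hypothesis** (all planes ⟹ one pair ⟹ mover), Galois logarithm.
[claim: Mochizuki2012, status: disputed] [cite: Kondo2025OuterAutMLF, §2 Thm 2.1 and proof of Thm 2.3 p.10] -/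
theorem exists_mem_ind1StripOf_galoisLog_image_closedBall_ne_of_dehnTwistsAll (hJW : DehnTwistTransvectionsOnUnitsAll)
    (p : ℕ) [Fact p.Prime] (hv : ((p : ℕ) : 𝓞 F) ∈ v.asIdeal) (hp2 : p ≠ 2)
    (hf : v.asIdeal.inertiaDeg ℤ = 1) (he : 3 ≤ v.asIdeal.ramificationIdx ℤ)
    {ϖ : (RescaledCompletion F p v hv)ˣ} (hϖ : IsUniformizer ϖ) :
    ∃ χ ∈ ind1StripOf v (galoisLog v), ∃ m : ℤ,
      (fun x => RescaledCompletion.of F p v hv (χ ((RescaledCompletion.of F p v hv).symm x))) ''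
          closedBall (0 : RescaledCompletion F p v hv) (‖(ϖ : RescaledCompletion F p v hv)‖ ^ m) ≠
        closedBall (0 : RescaledCompletion F p v hv) (‖(ϖ : RescaledCompletion F p v hv)‖ ^ m) :=
  exists_mem_ind1StripOf_galoisLog_image_closedBall_ne_of_dehnTwistsOnUnits v
    (dehnTwistTransvectionsOnUnits_of_all hJW) p hv hp2 hf he hϖ

/-- **The same over abc-iut-c312-5's analytic logarithm.**
[claim: Mochizuki2012, status: disputed] [cite: Kondo2025OuterAutMLF, §2 Thm 2.1 and proof of Thm 2.3 p.10] -/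
theorem exists_mem_ind1StripOf_analyticLogv_image_closedBall_ne_of_dehnTwistsAll (hJW : DehnTwistTransvectionsOnUnitsAll)
    (p : ℕ) [Fact p.Prime] (hv : ((p : ℕ) : 𝓞 F) ∈ v.asIdeal) (hp2 : p ≠ 2)
    (hf : v.asIdeal.inertiaDeg ℤ = 1) (he : 3 ≤ v.asIdeal.ramificationIdx ℤ)
    {ϖ : (RescaledCompletion F p v hv)ˣ} (hϖ : IsUniformizer ϖ) :
    ∃ χ ∈ ind1StripOf v (analyticLogv F v), ∃ m : ℤ,
      (fun x => RescaledCompletion.of F p v hv (χ ((RescaledCompletion.of F p v hv).symm x))) ''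
          closedBall (0 : RescaledCompletion F p v hv) (‖(ϖ : RescaledCompletion F p v hv)‖ ^ m) ≠
        closedBall (0 : RescaledCompletion F p v hv) (‖(ϖ : RescaledCompletion F p v hv)‖ ^ m) :=
  exists_mem_ind1StripOf_analyticLogv_image_closedBall_ne_of_dehnTwistsOnUnits v
    (dehnTwistTransvectionsOnUnits_of_all hJW) p hv hp2 hf he hϖ

end Summit.ABC.IUTFork.Thm311.Real

end
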